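import Summits.BirchSwinnertonDyer.BirchSwinnertonDyer.Theorems.ByReductionTypeAtTwoOrdKatoHalfAtTwoIsoZetaNotTwoDivisible
import Summits.BirchSwinnertonDyer.BirchSwinnertonDyer.Theorems.ThetaPartnerAtTwoSignedKatoUpToAtTwoOffTwoESClass
import Summits.BirchSwinnertonDyer.BirchSwinnertonDyer.Theorems.ThetaPartnerAtTwoSignedKatoUpToAtTwoInvolChainRank
import Literature.NumberTheory.EllipticCurves.Kato2004.IwasawaH1RankLowerBoundProofs
import HarnessLib

/-!
# Route ByReductionTypeAtTwo, crux `OrdKatoHalfAtTwoIso` (stmt-BirchSwinnertonDyer-19573), line `steinberg-fibre-at-two`,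
# F1 slot (child stmt-BirchSwinnertonDyer-24097): **Kato's Thm. 12.4 at `p = 2` is KERNEL on the crux HABITAT** (analytic rank `0`,
# `ρ̄₂` onto / `W[2]` irreducible) **modulo Kato's construction fact and Gross–Zagier–Kolyvagin** — `𝐇¹_Γ(T₂W)` is Λ-free of rank ONE with a
# generator — so that on the habitat sub-cell of the `Δ < 0` cell MU13⁻ ⟺ N2D⁻ holds WITHOUT the named fact `Kato2004.thm12_4`; and, on the
# whole (rank-free) cell, the memo stub MU13⁻ itself CARRIES the upper half of Thm. 12.4 (2) (`rank_Λ 𝐇¹_Γ ≤ 1`, weak Leopoldt at `2`)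

Seat `cruxlead-stmt-BirchSwinnertonDyer-19573-w3` g9 (prover WIDTH; LEAD lineage SUMMON-only; HOME `run/shared/lean/pub/bsd-2adic/`;
`--supports` stmt-BirchSwinnertonDyer-24097). THEOREMS ONLY (no definition, no named fact, no `sorry`, no instance). HONEST FRAMING (cell
bsd-2adic): BSD is not proved by any of this; nothing is closed; the research content of the F1 slot (G11⁺, G11⁻, N2D⁻) is untouched. What this
file does is binder hygiene on ONE print input of the `Δ < 0` doors: wherever the lineage's doors take `(h12 : Kato2004.thm12_4)` (w3 g7
`zetaQuotientMu_iff_notTwoDivisible`, `IwasawaH1Data.moduleFinite_quotient_span_iff_not_mem_smul_top`, …) ONLY to know that the pinned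
`𝐇¹_Γ(T₂W)` has Λ-rank exactly `1`, that input is a THEOREM at every HABITAT curve (non-CM is not even needed: analytic rank `0` and `W[2]`
irreducible suffice) modulo the two facts the line's PUB bundle and Kato's construction already carry:

* upper half `rank_Λ 𝐇¹_Γ(T₂W) ≤ 1` ⟸ Gross–Zagier–Kolyvagin (`rank_eq_analyticRank_of_analyticRank_le_one`, the second conjunct of
  `OrdPublishedInputsAtTwo`) in analytic rank `0`: (R0) `rank_{ℤ₂} H¹(ℤ[1/2], T₂W) ≤ 1` for `W(ℚ)`, `Ш[2^∞]` finite (cell `bsd-potss`, rkm g9,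
  `IntegralH1RankZero.rank_integralH1_layerZero_le_one`, Kato Thm. 14.5 (1)/14.13, Euler-system free) and Kato's (14.14.1)-injectivity on the pin
  (`IwasawaH1Data.rank_le_one_of_rank_integralH1_le_one`) — packaged by cell `bsd-wall` as `SignedKatoOffTwo.rank_iwasawaH1_le_one_of_gzk`;
* lower half `𝐇¹_Γ(T₂W) ≠ 0` ⟸ Kato's construction fact `Kato2004.exists_eulerSystem_expStar_values` ((8.1.3)/Ex. 13.3 with Thm. 9.7 / 6.6 (1),
  no parity hypothesis): a NON-ZERO genuine `2`-adic Euler-system class exists in every pinned `𝐇¹_Γ(T₂W)` when `W[2]` is irreducible and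
  `L(W,1) ≠ 0` (cell `bsd-wall`, `SignedKatoOffTwo.ESClassTwo.exists_isEulerSystemClassTwo_ne_zero`: the bottom class `z_{0,∅}` has the value
  `κ·L_{(2A)}(f,1)/Ω⁺_f·R⁻ ≠ 0`);
* (12.2.1) finite generation, Thm. 12.4 (2) torsion-freeness and Thm. 12.4 (3) freeness at `p = 2` for irreducible `W[2]` are tree theorems
  (`IwasawaH1Data.module_finite_of_isCyclotomic`, `.isTorsionFree`, `.moduleFree_of_hasIrreducibleModPGaloisRep`, w3 g7).

## Contents
* §0 (algebra over `Λ = ℤ_p⟦X⟧`, every `p`) `rank_quotient_span_eq_zero_of_moduleFinite` / `rank_le_one_of_moduleFinite_quotient_span`: a `Λ`-module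
  `M` with a class `z` such that `M ⧸ Λz` is finitely generated over `ℤ_p` has `rank_Λ M ≤ 1` (rank–nullity over the domain `Λ`; every element
  of `M ⧸ Λz` is killed by an `X`-monic polynomial); `thm12_4_clauses_pin_of_rank_le_one_of_nontrivial`: at a pin with `W[p]` irreducible,
  `rank ≤ 1` and `𝐇¹ ≠ 0` give ALL clauses of `thm12_4` (f.g., torsion free, rank `1`, free, finrank `1`) and a generator.
* §1 (`p = 2`, habitat) `nontrivial_iwasawaH1_two_of_habitat`, **`thm12_4_clauses_two_of_habitat`** (binders: `W[2]` irreducible, a newform `f` of `W`,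
  `r_an(W) = 0`; facts: `hES`, `h17` = GZK), `thm12_4_clauses_two_of_habitat_of_pub` (the same from the line's PUB item and `ρ̄₂` onto),
  `exists_generator_two_of_habitat`, and **`moduleFinite_quotient_span_iff_not_mem_smul_top_two_of_habitat`**: at every habitat pin and every class
  `z`, `μ(𝐇¹_Γ/Λz) = 0 ⟺ z ∉ 2·𝐇¹_Γ` — the MU13⁻/N2D⁻ dictionary of w3 g7 with `thm12_4` DISCHARGED.
* §2 (`p = 2`, the rank-free `Δ < 0` cell) **`rank_le_one_of_zetaQuotientMuZero`**: the memo stub MU13⁻ (`ZetaQuotientMuZeroTwoOrdNegDisc`) by itself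
  gives `rank_Λ 𝐇¹_Γ(T₂W) ≤ 1` at EVERY pin of EVERY curve of the cell (any analytic rank) — i.e. MU13⁻ silently contains the upper half of Kato
  Thm. 12.4 (2) at `2` (weak Leopoldt for `E` along `ℚ_∞/ℚ` at `p = 2`) on the cell; `thm12_4_clauses_of_zetaQuotientMuZero_of_nontrivial`: with
  `𝐇¹_Γ ≠ 0` (hypothesis; at habitat curves §1, in every analytic rank the `p = 2` Rohrlich port under way in cell seat addL2x's road R-B83) MU13⁻
  yields every clause of `thm12_4` at that pin. PRICING REMARK for the LEAD / triage (no statement of the line changes): the registered memo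
  content V♭⁻ ⟺ G11⁻ ∧ MU13⁻ is therefore NOT «internal to the Euler system» only — it asserts weak Leopoldt at `2` on the rank-free cell; the
  N2D⁻ form (V♭⁻ ⟺ G11⁻ ∧ N2D⁻, w3 g7) does not, and needs `thm12_4`'s rank clause exactly for `rank ≤ 1` in positive analytic rank.

References: [Kato2004Asterisque] §12.2 (12.2.1)–(12.2.2) (p. 220), Thm. 12.4 (2)(3) (p. 221), Thm. 12.5 (1) (pp. 221–222), Ex. 13.3 (p. 225), Thm. 13.4 (i)
(p. 226), §13.8 (pp. 228–229), Thm. 14.5 (1) (p. 236), §14.14 (14.14.1) (p. 243); [GreenbergLNM1716] Conj. 1.11 (p. 64); [Darmon2004] Thm. 3.22 (GZK);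
tree: w3 g7 p738189/p738787, rkm g9 `…IntegralH1RankZero`, bsd-wall `…OffTwoESClass` / `…InvolChainRank`, `Kato2004/IwasawaH1RankLowerBoundProofs`.
-/

set_option autoImplicit false
set_option linter.dupNamespace false

noncomputable section

open scoped Classical MatrixGroups ModularForm NumberField
open CongruenceSubgroup WeierstrassCurve Field IsDedekindDomain NumberField
open Literature.NumberTheory.GaloisRepresentations
open Literature.NumberTheory.GaloisCohomology
open Literature.NumberTheory.EllipticCurves Literature.NumberTheory.EllipticCurves.ModularForms
  Literature.NumberTheory.EllipticCurves.GreenbergSelmer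
open Literature.NumberTheory.EllipticCurves.Kato2004
  Literature.NumberTheory.EllipticCurves.Kato2004.EulerSystemValues
open Literature.NumberTheory.EllipticCurves.IwasawaDual
open Literature.NumberTheory.EllipticCurves.Rank1Residual
open Literature.NumberTheory.EllipticCurves.Greenberg1999
open Summit.BirchSwinnertonDyer.Rank1Residual Summit.BirchSwinnertonDyer.Rank1Residual.X5
open Summit.BirchSwinnertonDyer.BirchSwinnertonDyer.Theses.ByReductionTypeAtTwo

namespace Summit.BirchSwinnertonDyer.BirchSwinnertonDyer.Theorems.SteinbergFibreAtTwo

/-! ## §0 Algebra over `Λ = ℤ_p⟦X⟧` (every `p`): a zeta quotient of `μ`-invariant zero forces `rank_Λ ≤ 1` -/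

section Algebra

variable {p : ℕ} [Fact p.Prime]

/-- **A `Λ`-module finitely generated over `ℤ_p` has `Λ`-rank `0`**: every element is killed by an `X`-monic polynomial
(`exists_monic_smul_eq_zero_of_moduleFinite`, Cayley–Hamilton over `ℤ_p`), which is non-zero (`∉ (p)`). Applied to a zeta quotient `M ⧸ Λz`.
[cite: Washington1997, §13.2 (structure of finitely generated Λ-modules, shape)] -/
theorem rank_quotient_span_eq_zero_of_moduleFinite {M : Type*} [AddCommGroup M] [Module (IwasawaAlgebra p) M] (z : M)
    (hfin : Module.Finite ℤ_[p] (RestrictScalars ℤ_[p] (IwasawaAlgebra p) (M ⧸ (IwasawaAlgebra p) ∙ z))) :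
    Module.rank (IwasawaAlgebra p) (M ⧸ (IwasawaAlgebra p) ∙ z) = 0 := by
  rw [rank_eq_zero_iff]
  intro x
  obtain ⟨n, c, hg⟩ := exists_monic_smul_eq_zero_of_moduleFinite hfin x
  refine ⟨_, fun h0 => X_pow_sub_sum_notMem_augIdealP (p := p) n c ?_, hg⟩
  rw [h0]
  exact Ideal.zero_mem _

/-- **`μ(M ⧸ Λz) = 0` for some class `z` forces `rank_Λ M ≤ 1`** (rank–nullity over the domain `Λ`: `rank M = rank (M ⧸ Λz) + rank Λz = 0 + rank Λz ≤ 1`).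
On Kato's carrier this says: a class with a zeta quotient of `μ`-invariant zero already gives the UPPER half of Kato Thm. 12.4 (2).
[cite: Kato2004Asterisque, Thm. 12.4 (2) (p. 221)] -/
theorem rank_le_one_of_moduleFinite_quotient_span {M : Type*} [AddCommGroup M] [Module (IwasawaAlgebra p) M] (z : M)
    (hfin : Module.Finite ℤ_[p] (RestrictScalars ℤ_[p] (IwasawaAlgebra p) (M ⧸ (IwasawaAlgebra p) ∙ z))) :
    Module.rank (IwasawaAlgebra p) M ≤ 1 := by
  rw [← rank_quotient_add_rank_of_isDomain ((IwasawaAlgebra p) ∙ z), rank_quotient_span_eq_zero_of_moduleFinite z hfin, zero_add]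
  exact (rank_span_le _).trans (by rw [Cardinal.mk_singleton])

end Algebra

/-! ## §0′ The clauses of `thm12_4` at ONE pin from `rank ≤ 1` and `𝐇¹ ≠ 0` (every `p`, `W[p]` irreducible) -/

section Pin

variable {W : WeierstrassCurve ℚ} [W.IsElliptic] {p : ℕ} [Fact p.Prime] [ContinuousSMul ℤ_[p] (W.tateModule p)]
  {κ : ZpExtension ℚ p} {γ : absoluteGaloisGroup ℚ}

/-- **All clauses of `Kato2004.thm12_4` at a pin, from `rank_Λ 𝐇¹_Γ ≤ 1` and `𝐇¹_Γ ≠ 0`** (`W[p]` irreducible): (12.2.1) finite generation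
(`module_finite_of_isCyclotomic`), Thm. 12.4 (2) torsion-freeness (`isTorsionFree`) and rank EXACTLY `1` (`one_le_rank_iwasawaH1_of_nontrivial`),
Thm. 12.4 (3) freeness (`moduleFree_of_hasIrreducibleModPGaloisRep`, every `p`) and `finrank = 1`. [cite: Kato2004Asterisque, §12.2 (12.2.1) (p. 220), Thm. 12.4 (2)(3) (p. 221)] -/
theorem thm12_4_clauses_pin_of_rank_le_one_of_nontrivial (hκ : κ.IsCyclotomic) (hγ : κ.IsTopGenerator γ)
    (I : IwasawaH1Data W p κ γ) (hirr : W.HasIrreducibleModPGaloisRep p) [Nontrivial I.H]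
    (hrk : Module.rank (IwasawaAlgebra p) I.H ≤ 1) :
    Module.Finite (IwasawaAlgebra p) I.H ∧
      (Module.IsTorsionFree (IwasawaAlgebra p) I.H ∧ Module.rank (IwasawaAlgebra p) I.H = 1) ∧
      (Module.Free (IwasawaAlgebra p) I.H ∧ Module.finrank (IwasawaAlgebra p) I.H = 1) := by
  have hrk1 : Module.rank (IwasawaAlgebra p) I.H = 1 := le_antisymm hrk (one_le_rank_iwasawaH1_of_nontrivial hγ I)
  exact ⟨IwasawaH1Data.module_finite_of_isCyclotomic hκ hγ I, ⟨I.isTorsionFree hγ, hrk1⟩,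
    I.moduleFree_of_hasIrreducibleModPGaloisRep hκ hγ hirr, Module.finrank_eq_of_rank_eq (by rw [hrk1, Nat.cast_one])⟩

/-- **A generator at a pin from `rank ≤ 1` and `𝐇¹ ≠ 0`** (`W[p]` irreducible): `∃ e ≠ 0, 𝐇¹_Γ(T_pW) = Λ·e`.
[cite: Kato2004Asterisque, Thm. 12.4 (2)(3) (p. 221)] -/
theorem exists_generator_pin_of_rank_le_one_of_nontrivial (hκ : κ.IsCyclotomic) (hγ : κ.IsTopGenerator γ)
    (I : IwasawaH1Data W p κ γ) (hirr : W.HasIrreducibleModPGaloisRep p) [Nontrivial I.H]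
    (hrk : Module.rank (IwasawaAlgebra p) I.H ≤ 1) :
    ∃ e : I.H, e ≠ 0 ∧ ∀ x : I.H, ∃ a : IwasawaAlgebra p, x = a • e := by
  obtain ⟨-, ⟨-, hrk1⟩, hfree, -⟩ := thm12_4_clauses_pin_of_rank_le_one_of_nontrivial hκ hγ I hirr hrk
  haveI := hfree
  exact exists_generator_of_moduleFree_of_rank_eq_one hrk1

/-- **`μ(𝐇¹_Γ ⧸ Λz) = 0 ⟺ z ∉ p·𝐇¹_Γ` at a pin, from `rank ≤ 1` and `𝐇¹ ≠ 0`** (`W[p]` irreducible) — w3 g7's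
`IwasawaH1Data.moduleFinite_quotient_span_iff_not_mem_smul_top` with its `thm12_4` hypothesis replaced by exactly what it used.
[cite: Kato2004Asterisque, Thm. 12.4 (2)(3) (p. 221), §13.8 (pp. 228–229)] -/
theorem moduleFinite_quotient_span_iff_not_mem_smul_top_pin_of_rank_le_one_of_nontrivial (hκ : κ.IsCyclotomic)
    (hγ : κ.IsTopGenerator γ) (I : IwasawaH1Data W p κ γ) (hirr : W.HasIrreducibleModPGaloisRep p) [Nontrivial I.H]
    (hrk : Module.rank (IwasawaAlgebra p) I.H ≤ 1) (z : I.H) :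
    Module.Finite ℤ_[p] (RestrictScalars ℤ_[p] (IwasawaAlgebra p) (I.H ⧸ (IwasawaAlgebra p) ∙ z)) ↔
      z ∉ IwasawaAlgebra.augIdealP p • (⊤ : Submodule (IwasawaAlgebra p) I.H) := by
  refine ⟨fun hfin => I.not_mem_augIdealP_smul_top_of_moduleFinite_quotient_span hγ hfin, fun hz => ?_⟩
  haveI := I.noZeroSMulDivisors hγ
  obtain ⟨e, he, hgen⟩ := exists_generator_pin_of_rank_le_one_of_nontrivial hκ hγ I hirr hrk
  exact moduleFinite_quotient_span_of_generator_of_not_mem_augIdealP_smul_top he hgen hz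

end Pin

/-! ## §1 `p = 2` on the crux HABITAT: Kato Thm. 12.4 modulo the construction fact and Gross–Zagier–Kolyvagin -/

section Habitat

variable (W : WeierstrassCurve ℚ) [W.IsElliptic] [ContinuousSMul ℤ_[2] (W.tateModule 2)]
  [Module.Free ℤ_[2] (W.tateModule 2)] [Module.Finite ℤ_[2] (W.tateModule 2)]
  {κ : ZpExtension ℚ 2} {γ : absoluteGaloisGroup ℚ}

/-- **`𝐇¹_Γ(T₂W) ≠ 0` on the habitat, modulo Kato's construction fact**: for `W[2]` irreducible, `f` a newform of `W` and `r_an(W) = 0`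
(so `L(W,1) ≠ 0`), every pinned `𝐇¹_Γ(T₂W)` over a cyclotomic `κ` contains a NON-ZERO genuine `2`-adic Euler-system class (cell `bsd-wall`,
`SignedKatoOffTwo.ESClassTwo.exists_isEulerSystemClassTwo_ne_zero`), hence is non-trivial. The `p = 2` lower half of Kato Thm. 12.4 (2) / (12.2.2) in
analytic rank `0`. [cite: Kato2004Asterisque, Thm. 12.5 (1) (pp. 221–222), Ex. 13.3 (p. 225), §12.2 (12.2.2) (p. 220)] -/
theorem nontrivial_iwasawaH1_two_of_habitat (hES : Kato2004.exists_eulerSystem_expStar_values)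
    (hirr : W.HasIrreducibleModPGaloisRep 2) {N : ℕ} [NeZero N] (f : CuspForm (Gamma0 N) 2) (hf : IsNewformOf W f)
    (hr : W.analyticRank = 0) (hκ : κ.IsCyclotomic) (I : IwasawaH1Data W 2 κ γ) : Nontrivial I.H := by
  obtain ⟨s, -, hs⟩ := SignedKatoOffTwo.ESClassTwo.exists_isEulerSystemClassTwo_ne_zero W hκ I hES hirr f hf
    (SignedKatoOffTwo.ESClassTwo.entireLFunction_one_ne_zero_of_analyticRank_eq_zero W f hf hr)
  exact nontrivial_of_ne s 0 hs

/-- **Kato Thm. 12.4 at `p = 2` on the habitat is KERNEL modulo {construction fact, GZK}.** For every elliptic `W/ℚ` with `W[2]` irreducible,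
a newform `f`, and analytic rank `0`, every cyclotomic `κ` with topological generator `γ` and every pin `I : IwasawaH1Data W 2 κ γ`:
`𝐇¹_Γ(T₂W)` is finitely generated, torsion free of Λ-rank `1`, free of finrank `1` — the three clauses of the named fact `Kato2004.thm12_4` at
`(W, 2, κ, γ, I)` — GRANTED `hES` (Kato (8.1.3)/Ex. 13.3, Thm. 9.7, Thm. 6.6 (1)) and `h17` (Gross–Zagier–Kolyvagin): upper half by
`SignedKatoOffTwo.rank_iwasawaH1_le_one_of_gzk` ((R0) + (14.14.1)), lower half by `nontrivial_iwasawaH1_two_of_habitat`.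
[cite: Kato2004Asterisque, §12.2 (12.2.1) (p. 220), Thm. 12.4 (2)(3) (p. 221), Thm. 14.5 (1) (p. 236), §14.14 (14.14.1) (p. 243)] [cite: Darmon2004, Thm. 3.22] -/
theorem thm12_4_clauses_two_of_habitat (hES : Kato2004.exists_eulerSystem_expStar_values)
    (h17 : rank_eq_analyticRank_of_analyticRank_le_one) (hirr : W.HasIrreducibleModPGaloisRep 2)
    {N : ℕ} [NeZero N] (f : CuspForm (Gamma0 N) 2) (hf : IsNewformOf W f) (hr : W.analyticRank = 0)
    (hκ : κ.IsCyclotomic) (hγ : κ.IsTopGenerator γ) (I : IwasawaH1Data W 2 κ γ) :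
    Module.Finite (IwasawaAlgebra 2) I.H ∧
      (Module.IsTorsionFree (IwasawaAlgebra 2) I.H ∧ Module.rank (IwasawaAlgebra 2) I.H = 1) ∧
      (Module.Free (IwasawaAlgebra 2) I.H ∧ Module.finrank (IwasawaAlgebra 2) I.H = 1) := by
  haveI := nontrivial_iwasawaH1_two_of_habitat W hES hirr f hf hr hκ I
  exact thm12_4_clauses_pin_of_rank_le_one_of_nontrivial hκ hγ I hirr (SignedKatoOffTwo.rank_iwasawaH1_le_one_of_gzk h17 hr hκ hγ I)

/-- **A generator of `𝐇¹_Γ(T₂W)` on the habitat** (`∃ e ≠ 0, 𝐇¹_Γ = Λ·e`), modulo {construction fact, GZK}.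
[cite: Kato2004Asterisque, Thm. 12.4 (2)(3) (p. 221)] -/
theorem exists_generator_two_of_habitat (hES : Kato2004.exists_eulerSystem_expStar_values)
    (h17 : rank_eq_analyticRank_of_analyticRank_le_one) (hirr : W.HasIrreducibleModPGaloisRep 2)
    {N : ℕ} [NeZero N] (f : CuspForm (Gamma0 N) 2) (hf : IsNewformOf W f) (hr : W.analyticRank = 0)
    (hκ : κ.IsCyclotomic) (hγ : κ.IsTopGenerator γ) (I : IwasawaH1Data W 2 κ γ) :
    ∃ e : I.H, e ≠ 0 ∧ ∀ x : I.H, ∃ a : IwasawaAlgebra 2, x = a • e := by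
  haveI := nontrivial_iwasawaH1_two_of_habitat W hES hirr f hf hr hκ I
  exact exists_generator_pin_of_rank_le_one_of_nontrivial hκ hγ I hirr (SignedKatoOffTwo.rank_iwasawaH1_le_one_of_gzk h17 hr hκ hγ I)

/-- **MU13-shape ⟺ N2D-shape at every habitat pin WITHOUT `thm12_4`**: for every class `z ∈ 𝐇¹_Γ(T₂W)`, `𝐇¹_Γ ⧸ Λz` is finitely generated over `ℤ₂`
iff `z ∉ 2·𝐇¹_Γ`, modulo {construction fact, GZK} (`W[2]` irreducible, `r_an = 0`). [cite: Kato2004Asterisque, Thm. 12.4 (2)(3) (p. 221), §13.8 (pp. 228–229)] -/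
theorem moduleFinite_quotient_span_iff_not_mem_smul_top_two_of_habitat (hES : Kato2004.exists_eulerSystem_expStar_values)
    (h17 : rank_eq_analyticRank_of_analyticRank_le_one) (hirr : W.HasIrreducibleModPGaloisRep 2)
    {N : ℕ} [NeZero N] (f : CuspForm (Gamma0 N) 2) (hf : IsNewformOf W f) (hr : W.analyticRank = 0)
    (hκ : κ.IsCyclotomic) (hγ : κ.IsTopGenerator γ) (I : IwasawaH1Data W 2 κ γ) (z : I.H) :
    Module.Finite ℤ_[2] (RestrictScalars ℤ_[2] (IwasawaAlgebra 2) (I.H ⧸ (IwasawaAlgebra 2) ∙ z)) ↔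
      z ∉ IwasawaAlgebra.augIdealP 2 • (⊤ : Submodule (IwasawaAlgebra 2) I.H) := by
  haveI := nontrivial_iwasawaH1_two_of_habitat W hES hirr f hf hr hκ I
  exact moduleFinite_quotient_span_iff_not_mem_smul_top_pin_of_rank_le_one_of_nontrivial hκ hγ I hirr
    (SignedKatoOffTwo.rank_iwasawaH1_le_one_of_gzk h17 hr hκ hγ I) z

/-- **The same with the habitat binders of the crux** (`W` globally minimal, `ρ̄_{W,2}` onto, analytic rank `0`) **and the facts taken from the
line's PUB item** `OrdPublishedInputsAtTwo` (modularity supplies the newform; its second conjunct is GZK): Kato Thm. 12.4 at `p = 2` on the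
habitat is kernel modulo {construction fact, PUB}. [cite: Kato2004Asterisque, Thm. 12.4 (2)(3) (p. 221)] [cite: Darmon2004, Thm. 3.22] -/
theorem thm12_4_clauses_two_of_habitat_of_pub [W.IsGloballyMinimal] (hES : Kato2004.exists_eulerSystem_expStar_values)
    (hPub : OrdPublishedInputsAtTwo) (h2 : W.HasSurjectiveModNGaloisRep 2) (hr : W.analyticRank = 0)
    (hκ : κ.IsCyclotomic) (hγ : κ.IsTopGenerator γ) (I : IwasawaH1Data W 2 κ γ) :
    Module.Finite (IwasawaAlgebra 2) I.H ∧
      (Module.IsTorsionFree (IwasawaAlgebra 2) I.H ∧ Module.rank (IwasawaAlgebra 2) I.H = 1) ∧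
      (Module.Free (IwasawaAlgebra 2) I.H ∧ Module.finrank (IwasawaAlgebra 2) I.H = 1) := by
  obtain ⟨hmod, h17, -, -⟩ := hPub
  haveI : NeZero (W.conductorNorm ℤ) := ⟨(W.conductorNorm_pos_holds).ne'⟩
  obtain ⟨Dm⟩ := hmod W
  exact thm12_4_clauses_two_of_habitat W hES h17 (hasIrreducibleModPGaloisRep_of_hasSurjectiveModNGaloisRep W 2 h2) _
    Dm.isNewformOf hr hκ hγ I

end Habitat

/-! ## §2 `p = 2` on the rank-free `Δ < 0` cell: the memo stub MU13⁻ carries `rank_Λ 𝐇¹_Γ(T₂W) ≤ 1` -/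

/-- **MU13⁻ ⟹ the upper half of Kato Thm. 12.4 (2) at `2` on the whole `Δ < 0` cell (any analytic rank).** If `ZetaQuotientMuZeroTwoOrdNegDisc`
holds then at every curve of the cell [good ordinary at `2`, `ρ̄₂` onto, `Δ < 0`], every normalised cyclotomic pair and EVERY pin, `rank_Λ 𝐇¹_Γ(T₂W) ≤ 1`
(§0 applied to the witnessing genuine class). PRICING REMARK: the registered memo content in MU13⁻-form asserts weak Leopoldt at `2` on the rank-free
cell; nothing of the line changes. [cite: Kato2004Asterisque, Thm. 12.4 (2) (p. 221), §17.13 (pp. 279–280)] -/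
theorem rank_le_one_of_zetaQuotientMuZero (hMU : ZetaQuotientMuZeroTwoOrdNegDisc)
    (W : WeierstrassCurve ℚ) [W.IsElliptic] [W.IsGloballyMinimal]
    [ContinuousSMul ℤ_[2] (W.tateModule 2)] [Module.Free ℤ_[2] (W.tateModule 2)] [Module.Finite ℤ_[2] (W.tateModule 2)]
    (κ : ZpExtension ℚ 2) (γ : absoluteGaloisGroup ℚ) (hκ : κ.IsCyclotomic) (hγ : κ.IsTopGenerator γ)
    (hΔ : W.Δ < 0) (hord : IsOrdinaryAt W 2) (h2 : W.HasSurjectiveModNGaloisRep 2) (hγ' : IsCyclotomicVariable 2 γ)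
    (I : IwasawaH1Data W 2 κ γ) : Module.rank (IwasawaAlgebra 2) I.H ≤ 1 := by
  obtain ⟨z, -, hz⟩ := hMU W κ γ hκ hγ hΔ hord h2 hγ' I
  exact rank_le_one_of_moduleFinite_quotient_span z hz

/-- **MU13⁻ + `𝐇¹_Γ ≠ 0` ⟹ every clause of `thm12_4` at that pin** (`Δ < 0` cell; `W[2]` irreducible from `ρ̄₂` onto). The lower half `𝐇¹_Γ ≠ 0` is a
displayed hypothesis: §1 discharges it at habitat curves (`r_an = 0`), and in every analytic rank it is the `p = 2` Rohrlich non-vanishing (Kato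
Thm. 12.5 (1)) under way elsewhere in the cell. [cite: Kato2004Asterisque, Thm. 12.4 (2)(3) (p. 221), Thm. 12.5 (1) (pp. 221–222)] -/
theorem thm12_4_clauses_of_zetaQuotientMuZero_of_nontrivial (hMU : ZetaQuotientMuZeroTwoOrdNegDisc)
    (W : WeierstrassCurve ℚ) [W.IsElliptic] [W.IsGloballyMinimal]
    [ContinuousSMul ℤ_[2] (W.tateModule 2)] [Module.Free ℤ_[2] (W.tateModule 2)] [Module.Finite ℤ_[2] (W.tateModule 2)]
    (κ : ZpExtension ℚ 2) (γ : absoluteGaloisGroup ℚ) (hκ : κ.IsCyclotomic) (hγ : κ.IsTopGenerator γ)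
    (hΔ : W.Δ < 0) (hord : IsOrdinaryAt W 2) (h2 : W.HasSurjectiveModNGaloisRep 2) (hγ' : IsCyclotomicVariable 2 γ)
    (I : IwasawaH1Data W 2 κ γ) [Nontrivial I.H] :
    Module.Finite (IwasawaAlgebra 2) I.H ∧
      (Module.IsTorsionFree (IwasawaAlgebra 2) I.H ∧ Module.rank (IwasawaAlgebra 2) I.H = 1) ∧
      (Module.Free (IwasawaAlgebra 2) I.H ∧ Module.finrank (IwasawaAlgebra 2) I.H = 1) :=
  thm12_4_clauses_pin_of_rank_le_one_of_nontrivial hκ hγ I (hasIrreducibleModPGaloisRep_of_hasSurjectiveModNGaloisRep W 2 h2)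
    (rank_le_one_of_zetaQuotientMuZero hMU W κ γ hκ hγ hΔ hord h2 hγ' I)

/-- **N2D⁻ ⟹ MU13⁻ at a pin of the `Δ < 0` cell from `rank_Λ 𝐇¹_Γ ≤ 1` ALONE** (no lower half needed: if `𝐇¹_Γ = 0` the N2D⁻ witness `z ∉ 2·𝐇¹_Γ`
cannot exist). So of `thm12_4` the door N2D⁻ ⟹ MU13⁻ (w3 g7 `zetaQuotientMu_of_notTwoDivisible`) consumes exactly the weak-Leopoldt half.
[cite: Kato2004Asterisque, Thm. 12.4 (2)(3) (p. 221), §13.8 (pp. 228–229)] -/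
theorem moduleFinite_quotient_span_of_not_mem_smul_top_of_rank_le_one
    {W : WeierstrassCurve ℚ} [W.IsElliptic] {p : ℕ} [Fact p.Prime] [ContinuousSMul ℤ_[p] (W.tateModule p)]
    {κ : ZpExtension ℚ p} {γ : absoluteGaloisGroup ℚ} (hκ : κ.IsCyclotomic) (hγ : κ.IsTopGenerator γ)
    (I : IwasawaH1Data W p κ γ) (hirr : W.HasIrreducibleModPGaloisRep p) (hrk : Module.rank (IwasawaAlgebra p) I.H ≤ 1)
    {z : I.H} (hz : z ∉ IwasawaAlgebra.augIdealP p • (⊤ : Submodule (IwasawaAlgebra p) I.H)) :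
    Module.Finite ℤ_[p] (RestrictScalars ℤ_[p] (IwasawaAlgebra p) (I.H ⧸ (IwasawaAlgebra p) ∙ z)) := by
  have hz0 : z ≠ 0 := by
    rintro rfl
    exact hz (Submodule.zero_mem _)
  haveI : Nontrivial I.H := nontrivial_of_ne z 0 hz0
  exact (moduleFinite_quotient_span_iff_not_mem_smul_top_pin_of_rank_le_one_of_nontrivial hκ hγ I hirr hrk z).mpr hz

end Summit.BirchSwinnertonDyer.BirchSwinnertonDyer.Theorems.SteinbergFibreAtTwo

end
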